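import Summits.AtomisticToContinuum.FouriersLaw.Theorems.UnboundedHeatVariance.Negative.AbstractCage

/-!
# `CageBudgetFekete.UnboundedHeatVariance` / Negative (4): the lacunary cage —
# an infrared-charged spectrum whose heat variance does NOT tend to infinity

Support file (`--supports stmt-AtomisticToContinuum-15771`) of the crux disprover. U and the picked line's
analytic stub S3 (`birth`, `stub_spectralHeatVarianceUnbounded`) conclude `sup_τ V(τ) = ∞` (`∀ R ∃ τ ≥ 0, R < V τ`),
not `V(τ) → ∞`. The NATURAL STRENGTHENING to a limit (or to a linear lower envelope `cτ ≤ V(τ)` eventually —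
the Nash envelope of the sibling route CoercivePulse) is FALSE at the abstract/spectral level, even under S3's
infrared hypothesis: the lacunary spectral measure `ρ = Σₙ 4⁻ⁿ δ_{2⁻ⁿ}` has `∫ ω⁻² dρ = Σₙ 1 = ∞` (so S3 applies and
`sup V = ∞`), but along `τ_N = 2^N · 2π` every mode with `n ≤ N` has completed an integer number of periods and the
modes `n > N` contribute `Σ_{m≥1} 2(1 - cos(2π 2⁻ᵐ)) ≤ 4π²/3`: `V(τ_N) ≤ 22` for all `N`.

* `lacunary_isFiniteMeasure`, `integral_lacunary`, `lacunary_not_integrable_inv_sq` — the measure, its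
  integrals `∫ f dρ = Σ 4⁻ⁿ f(2⁻ⁿ)` for bounded measurable `f`, and its infrared charge.
* `lacunary_heatVariance_eq_tsum` — `V(τ) = Σₙ 2(1 - cos(2⁻ⁿτ))` (`τ ≥ 0`).
* `lacunary_heatVariance_dyadic_le` — `V(2^N · 2π) ≤ 22`.
* `not_tendsto_atTop_of_infrared` — ¬(∀ finite `ρ` with `0 < ρ{0} ∨ ¬Integrable (ω ↦ (ω²)⁻¹) ρ`,
  `V_ρ(τ) → ∞`); `not_linear_lower_envelope_of_infrared` — nor `∃ c > 0, cτ ≤ V_ρ(τ)` eventually.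

So the Cesàro–Fatou line delivers exactly the `sup` form and cannot be asked for more; a restatement of U as
`V → ∞` or `liminf V/τ > 0` would need chain-specific input beyond the spectral alternative. No new definitions
(the measure is written out; the lemmas take `hρ : ρ = Σₙ 4⁻ⁿ δ_{2⁻ⁿ}` as a hypothesis). refuter-cdisprove-stmt-AtomisticToContinuum-15771-0, 2026-08-17.
-/

noncomputable section

namespace Summit.AtomisticToContinuum.FouriersLaw.Theorems.UnboundedHeatVariance.Negative

open MeasureTheory Set Filter Topology
open scoped ENNReal

/-! ## §1 The measure -/

/-- Total mass of the lacunary measure `ρ = Σₙ 4⁻ⁿ δ_{2⁻ⁿ}`: `Σₙ 4⁻ⁿ` (as `ENNReal.ofReal` of the real geometric series). [folklore] -/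
theorem lacunary_univ {ρ : Measure ℝ}
    (hρ : ρ = Measure.sum (fun n : ℕ => ENNReal.ofReal ((1/4:ℝ) ^ n) • Measure.dirac ((1/2:ℝ) ^ n))) :
    ρ univ = ENNReal.ofReal (∑' n : ℕ, (1/4:ℝ) ^ n) := by
  rw [hρ, Measure.sum_apply _ MeasurableSet.univ]
  simp only [Measure.smul_apply, measure_univ, smul_eq_mul, mul_one]
  rw [ENNReal.ofReal_tsum_of_nonneg (fun n => by positivity)
    (summable_geometric_of_lt_one (by norm_num) (by norm_num))]

/-- The lacunary measure is finite (total mass `4/3`). [folklore] -/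
theorem lacunary_isFiniteMeasure {ρ : Measure ℝ}
    (hρ : ρ = Measure.sum (fun n : ℕ => ENNReal.ofReal ((1/4:ℝ) ^ n) • Measure.dirac ((1/2:ℝ) ^ n))) :
    IsFiniteMeasure ρ :=
  ⟨by rw [lacunary_univ hρ]; exact ENNReal.ofReal_lt_top⟩

/-- Integration against the lacunary measure: `∫ f dρ = Σₙ 4⁻ⁿ f(2⁻ⁿ)` for bounded measurable `f`. [folklore] -/
theorem integral_lacunary {ρ : Measure ℝ}
    (hρ : ρ = Measure.sum (fun n : ℕ => ENNReal.ofReal ((1/4:ℝ) ^ n) • Measure.dirac ((1/2:ℝ) ^ n)))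
    {f : ℝ → ℝ} (hf : Measurable f) {B : ℝ} (hb : ∀ x, |f x| ≤ B) :
    ∫ w, f w ∂ρ = ∑' n : ℕ, (1/4:ℝ) ^ n * f ((1/2:ℝ) ^ n) := by
  haveI := lacunary_isFiniteMeasure hρ
  have hint : Integrable f ρ :=
    (integrable_const B).mono' hf.aestronglyMeasurable (Eventually.of_forall fun x => by
      simpa [Real.norm_eq_abs] using hb x)
  rw [hρ] at hint ⊢
  rw [integral_sum_measure hint]
  refine tsum_congr fun n => ?_
  rw [integral_smul_measure, integral_dirac, ENNReal.toReal_ofReal (by positivity), smul_eq_mul]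

/-- The lacunary measure charges the infrared: `ω ↦ (ω²)⁻¹` is not `ρ`-integrable (`∫⁻ = Σₙ 4⁻ⁿ·4ⁿ = ∞`). [folklore] -/
theorem lacunary_not_integrable_inv_sq {ρ : Measure ℝ}
    (hρ : ρ = Measure.sum (fun n : ℕ => ENNReal.ofReal ((1/4:ℝ) ^ n) • Measure.dirac ((1/2:ℝ) ^ n))) :
    ¬ Integrable (fun w : ℝ => (w ^ 2)⁻¹) ρ := by
  intro h
  have hfin := h.hasFiniteIntegral
  rw [hasFiniteIntegral_iff_enorm, hρ, lintegral_sum_measure] at hfin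
  have hterm : ∀ n : ℕ, ∫⁻ w, ‖(w ^ 2)⁻¹‖ₑ ∂(ENNReal.ofReal ((1/4:ℝ) ^ n) • Measure.dirac ((1/2:ℝ) ^ n)) = 1 := by
    intro n
    rw [lintegral_smul_measure, lintegral_dirac, smul_eq_mul, Real.enorm_eq_ofReal (by positivity),
      ← ENNReal.ofReal_mul (by positivity)]
    have : (1/4:ℝ) ^ n * (((1/2:ℝ) ^ n) ^ 2)⁻¹ = 1 := by
      rw [← pow_mul, show ((1:ℝ)/2) ^ (n * 2) = (1/4) ^ n by rw [mul_comm, pow_mul]; norm_num,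
        mul_inv_cancel₀ (by positivity)]
    rw [this, ENNReal.ofReal_one]
  simp only [hterm, ENNReal.tsum_const_eq_top_of_ne_zero one_ne_zero, lt_self_iff_false] at hfin

/-! ## §2 The heat variance of the lacunary spectrum -/

/-- Its kernel: `C(s) = ∫cos(ωs)dρ = Σₙ 4⁻ⁿ cos(2⁻ⁿ s)`. [folklore] -/
theorem lacunary_kernel {ρ : Measure ℝ}
    (hρ : ρ = Measure.sum (fun n : ℕ => ENNReal.ofReal ((1/4:ℝ) ^ n) • Measure.dirac ((1/2:ℝ) ^ n))) (s : ℝ) :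
    ∫ w, Real.cos (w * s) ∂ρ = ∑' n : ℕ, (1/4:ℝ) ^ n * Real.cos ((1/2:ℝ) ^ n * s) :=
  integral_lacunary hρ (by fun_prop) (B := 1) fun x => Real.abs_cos_le_one _

/-- Its heat variance: `2∫_{(0,τ]} (τ-s) C(s) ds = Σₙ 2(1 - cos(2⁻ⁿ τ))` for `τ ≥ 0` (termwise integration,
justified by `Σₙ ∫‖·‖ ≤ τ² Σ 4⁻ⁿ`). [folklore] -/
theorem lacunary_heatVariance_eq_tsum {ρ : Measure ℝ}
    (hρ : ρ = Measure.sum (fun n : ℕ => ENNReal.ofReal ((1/4:ℝ) ^ n) • Measure.dirac ((1/2:ℝ) ^ n))) {τ : ℝ} (hτ : 0 ≤ τ) :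
    2 * ∫ s in Ioc (0:ℝ) τ, (τ - s) * ∫ w, Real.cos (w * s) ∂ρ
      = ∑' n : ℕ, 2 * (1 - Real.cos ((1/2:ℝ) ^ n * τ)) := by
  simp_rw [lacunary_kernel hρ]
  -- move `(τ - s)` inside the series
  have h1 : ∀ s : ℝ, (τ - s) * ∑' n : ℕ, (1/4:ℝ) ^ n * Real.cos ((1/2:ℝ) ^ n * s)
      = ∑' n : ℕ, (τ - s) * ((1/4:ℝ) ^ n * Real.cos ((1/2:ℝ) ^ n * s)) := fun s => by
    rw [tsum_mul_left]
  simp_rw [h1]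
  -- termwise integration
  set F : ℕ → ℝ → ℝ := fun n s => (τ - s) * ((1/4:ℝ) ^ n * Real.cos ((1/2:ℝ) ^ n * s)) with hF
  have hFint : ∀ n, Integrable (F n) (volume.restrict (Ioc (0:ℝ) τ)) := fun n =>
    (by fun_prop : Continuous (F n)).integrableOn_Ioc
  have hbound : ∀ n, ∀ s ∈ Ioc (0:ℝ) τ, ‖F n s‖ ≤ τ * (1/4:ℝ) ^ n := by
    intro n s hs
    simp only [hF, norm_mul, Real.norm_eq_abs]
    have h1 : |τ - s| ≤ τ := by rw [abs_le]; constructor <;> linarith [hs.1, hs.2]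
    have h2 : |((1:ℝ)/4) ^ n| = (1/4) ^ n := abs_of_nonneg (by positivity)
    have h3 : |Real.cos ((1/2:ℝ) ^ n * s)| ≤ 1 := Real.abs_cos_le_one _
    rw [h2]
    calc |τ - s| * ((1/4:ℝ) ^ n * |Real.cos ((1/2:ℝ) ^ n * s)|)
        ≤ τ * ((1/4:ℝ) ^ n * 1) := by gcongr
      _ = τ * (1/4:ℝ) ^ n := by ring
  have hnorm : ∀ n, ∫ s in Ioc (0:ℝ) τ, ‖F n s‖ ≤ τ * (1/4:ℝ) ^ n * τ := by
    intro n
    have := setIntegral_mono_on (hFint n).norm (integrableOn_const (by simp)) measurableSet_Ioc (hbound n)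
    rw [setIntegral_const, Real.volume_real_Ioc_of_le hτ, sub_zero, smul_eq_mul] at this
    linarith [this]
  have hsum : Summable fun n => ∫ s in Ioc (0:ℝ) τ, ‖F n s‖ :=
    Summable.of_nonneg_of_le (fun n => integral_nonneg fun s => norm_nonneg _) hnorm
      (((summable_geometric_of_lt_one (by norm_num) (by norm_num)).mul_left τ).mul_right τ)
  rw [← integral_tsum_of_summable_integral_norm hFint hsum, ← tsum_mul_left]
  refine tsum_congr fun n => ?_
  have hw : (1/2:ℝ) ^ n ≠ 0 := by positivity
  simp only [hF]
  rw [show (fun s => (τ - s) * ((1/4:ℝ) ^ n * Real.cos ((1/2:ℝ) ^ n * s)))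
      = fun s => (1/4:ℝ) ^ n * ((τ - s) * Real.cos ((1/2:ℝ) ^ n * s)) from funext fun s => by ring,
    integral_const_mul, integral_Ioc_sub_mul_cos hw hτ]
  have hsq : ((1/2:ℝ) ^ n) ^ 2 = (1/4:ℝ) ^ n := by
    rw [← pow_mul, mul_comm, pow_mul]; norm_num
  rw [hsq]
  field_simp

/-- Along `τ_N = 2^N · 2π` the lacunary heat variance stays below `22` (modes `n ≤ N` are in phase, the tail is
`≤ Σ_{m≥1} (2π 2⁻ᵐ)² = 4π²/3`). [folklore] -/
theorem lacunary_heatVariance_dyadic_le {ρ : Measure ℝ}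
    (hρ : ρ = Measure.sum (fun n : ℕ => ENNReal.ofReal ((1/4:ℝ) ^ n) • Measure.dirac ((1/2:ℝ) ^ n))) (N : ℕ) :
    2 * ∫ s in Ioc (0:ℝ) ((2:ℝ) ^ N * (2 * Real.pi)),
        ((2:ℝ) ^ N * (2 * Real.pi) - s) * ∫ w, Real.cos (w * s) ∂ρ ≤ 22 := by
  have hτ : (0:ℝ) ≤ (2:ℝ) ^ N * (2 * Real.pi) := by positivity
  rw [lacunary_heatVariance_eq_tsum hρ hτ]
  set f : ℕ → ℝ := fun n => 2 * (1 - Real.cos ((1/2:ℝ) ^ n * ((2:ℝ) ^ N * (2 * Real.pi)))) with hf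
  -- the tail terms and their bound
  have htail : ∀ m : ℕ, f (m + (N + 1)) ≤ 4 * Real.pi ^ 2 * (1/4:ℝ) ^ (m + 1) := by
    intro m
    have harg : (1/2:ℝ) ^ (m + (N + 1)) * ((2:ℝ) ^ N * (2 * Real.pi)) = (1/2:ℝ) ^ (m + 1) * (2 * Real.pi) := by
      rw [show m + (N + 1) = (m + 1) + N by ring, pow_add]
      have : (1/2:ℝ) ^ N * (2:ℝ) ^ N = 1 := by rw [← mul_pow]; norm_num
      calc (1/2:ℝ) ^ (m + 1) * (1/2:ℝ) ^ N * ((2:ℝ) ^ N * (2 * Real.pi))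
          = (1/2:ℝ) ^ (m + 1) * ((1/2:ℝ) ^ N * (2:ℝ) ^ N) * (2 * Real.pi) := by ring
        _ = (1/2:ℝ) ^ (m + 1) * (2 * Real.pi) := by rw [this, mul_one]
    simp only [hf]
    rw [harg]
    have hc := Real.one_sub_sq_div_two_le_cos (x := (1/2:ℝ) ^ (m + 1) * (2 * Real.pi))
    have hsq : ((1/2:ℝ) ^ (m + 1) * (2 * Real.pi)) ^ 2 = 4 * Real.pi ^ 2 * (1/4:ℝ) ^ (m + 1) := by
      rw [mul_pow, ← pow_mul, mul_comm (m + 1) 2, pow_mul]; norm_num; ring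
    nlinarith [hsq]
  -- the head terms vanish
  have hhead : ∀ n ∈ Finset.range (N + 1), f n = 0 := by
    intro n hn
    have hn' : n ≤ N := Nat.lt_succ_iff.1 (Finset.mem_range.1 hn)
    have harg : (1/2:ℝ) ^ n * ((2:ℝ) ^ N * (2 * Real.pi)) = ((2 ^ (N - n) : ℕ) : ℝ) * (2 * Real.pi) := by
      push_cast
      rw [← Nat.sub_add_cancel hn', pow_add, Nat.add_sub_cancel]
      have : (1/2:ℝ) ^ n * (2:ℝ) ^ n = 1 := by rw [← mul_pow]; norm_num
      calc (1/2:ℝ) ^ n * ((2:ℝ) ^ (N - n) * (2:ℝ) ^ n * (2 * Real.pi))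
          = ((1/2:ℝ) ^ n * (2:ℝ) ^ n) * (2:ℝ) ^ (N - n) * (2 * Real.pi) := by ring
        _ = (2:ℝ) ^ (N - n) * (2 * Real.pi) := by rw [this, one_mul]
    simp only [hf]
    rw [harg, Real.cos_nat_mul_two_pi]
    ring
  -- nonnegativity and summability of the terms
  have hf0 : ∀ n, 0 ≤ f n := fun n => by
    simp only [hf]; linarith [Real.cos_le_one ((1/2:ℝ) ^ n * ((2:ℝ) ^ N * (2 * Real.pi)))]
  have hgeo : Summable fun m : ℕ => 4 * Real.pi ^ 2 * (1/4:ℝ) ^ (m + 1) := by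
    have := (summable_geometric_of_lt_one (by norm_num : (0:ℝ) ≤ 1/4) (by norm_num)).mul_left
      (4 * Real.pi ^ 2 * (1/4:ℝ))
    refine this.congr fun m => ?_
    rw [pow_succ]; ring
  have hstail : Summable fun m : ℕ => f (m + (N + 1)) :=
    Summable.of_nonneg_of_le (fun m => hf0 _) htail hgeo
  have hs : Summable f := (summable_nat_add_iff (N + 1)).1 hstail
  rw [← hs.sum_add_tsum_nat_add (N + 1), Finset.sum_eq_zero hhead, zero_add]
  calc ∑' m : ℕ, f (m + (N + 1)) ≤ ∑' m : ℕ, 4 * Real.pi ^ 2 * (1/4:ℝ) ^ (m + 1) :=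
        hstail.tsum_le_tsum htail hgeo
    _ = 4 * Real.pi ^ 2 * (1/4:ℝ) * ∑' m : ℕ, (1/4:ℝ) ^ m := by
        rw [← tsum_mul_left]; refine tsum_congr fun m => ?_; rw [pow_succ]; ring
    _ = 4 * Real.pi ^ 2 * (1/4:ℝ) * (1 - 1/4)⁻¹ := by
        rw [tsum_geometric_of_lt_one (by norm_num) (by norm_num)]
    _ ≤ 22 := by nlinarith [Real.pi_le_four, Real.pi_pos]

/-! ## §3 The strengthenings are false -/

/-- **Infrared charge does not force `V → ∞`.** The lim-strengthening of `birth` S3 / of U's conclusion is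
false: the lacunary `ρ` is finite, `(ω²)⁻¹ ∉ L¹(ρ)`, yet `V(2^N·2π) ≤ 22` for every `N`. [folklore] -/
theorem not_tendsto_atTop_of_infrared :
    ¬ (∀ ρ : MeasureTheory.Measure ℝ, MeasureTheory.IsFiniteMeasure ρ →
        (0 < ρ {0} ∨ ¬ MeasureTheory.Integrable (fun w : ℝ => (w ^ 2)⁻¹) ρ) →
        Tendsto (fun τ : ℝ => 2 * ∫ s in Set.Ioc (0:ℝ) τ, (τ - s) * (∫ w : ℝ, Real.cos (w * s) ∂ρ))
          atTop atTop) := by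
  intro h
  have ht := h _ (lacunary_isFiniteMeasure rfl) (Or.inr (lacunary_not_integrable_inv_sq rfl))
  obtain ⟨A, hA⟩ := (tendsto_atTop_atTop.1 ht) 23
  obtain ⟨N, hN⟩ := exists_nat_gt A
  have hτ : A ≤ (2:ℝ) ^ N * (2 * Real.pi) := by
    have h1 : (N:ℝ) ≤ (2:ℝ) ^ N := by exact_mod_cast Nat.lt_two_pow_self.le
    have h2 : (1:ℝ) ≤ 2 * Real.pi := by linarith [Real.pi_gt_three]
    nlinarith [hN, h1, h2, pow_pos (two_pos : (0:ℝ) < 2) N]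
  have := hA _ hτ
  linarith [lacunary_heatVariance_dyadic_le rfl N]

/-- **Infrared charge does not force a linear lower envelope** (`∃ c > 0, τ₀, ∀ τ ≥ τ₀, cτ ≤ V(τ)`, the Nash
envelope of the sibling route CoercivePulse): false for the lacunary `ρ`. [folklore] -/
theorem not_linear_lower_envelope_of_infrared :
    ¬ (∀ ρ : MeasureTheory.Measure ℝ, MeasureTheory.IsFiniteMeasure ρ →
        (0 < ρ {0} ∨ ¬ MeasureTheory.Integrable (fun w : ℝ => (w ^ 2)⁻¹) ρ) →
        ∃ c τ₀ : ℝ, 0 < c ∧ ∀ τ : ℝ, τ₀ ≤ τ →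
          c * τ ≤ 2 * ∫ s in Set.Ioc (0:ℝ) τ, (τ - s) * (∫ w : ℝ, Real.cos (w * s) ∂ρ)) := by
  intro h
  obtain ⟨c, τ₀, hc, hle⟩ := h _ (lacunary_isFiniteMeasure rfl) (Or.inr (lacunary_not_integrable_inv_sq rfl))
  obtain ⟨N, hN⟩ := exists_nat_gt (max τ₀ (22 / c))
  have h1 : (N:ℝ) ≤ (2:ℝ) ^ N := by exact_mod_cast Nat.lt_two_pow_self.le
  have h2 : (1:ℝ) ≤ 2 * Real.pi := by linarith [Real.pi_gt_three]
  have hbig : (N:ℝ) ≤ (2:ℝ) ^ N * (2 * Real.pi) := by nlinarith [pow_pos (two_pos : (0:ℝ) < 2) N]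
  have hτ₀ : τ₀ ≤ (2:ℝ) ^ N * (2 * Real.pi) := ((le_max_left _ _).trans hN.le).trans hbig
  have hcN : 22 / c < (2:ℝ) ^ N * (2 * Real.pi) := ((le_max_right _ _).trans_lt hN).trans_le hbig
  have := hle _ hτ₀
  rw [div_lt_iff₀ hc] at hcN
  nlinarith [lacunary_heatVariance_dyadic_le rfl N, this]

end Summit.AtomisticToContinuum.FouriersLaw.Theorems.UnboundedHeatVariance.Negative

end
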